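import Literature.Computability.Cryptography.LiuPassLemma53Hiding
import HarnessLib

/-!
# Liu–Pass Lemma 5.3: `g` is `𝒮`-hiding — the advice-carrying coin budget and the contradiction

Completes `LiuPassLemma53Hiding.lean`: from the per-length inequality
`Pr[𝒜' inverts f over S_n] ≥ ½ · hidingProb(g, 𝒜, n)` (`L53Params.sInvertProb_ge`, valid whenever
`𝒜'`'s coin count on the inputs `⟨1ⁿ, f x⟩` carries the advice `(r(n), κ)`), we derive

  `IsSOWF f S → IsRegularOver f S r → IsSaturated f S → (|f x| ≤ P |x|) → hidRun_polyTime →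
     IsHidingOver (g r) S m`   (`L53Params.isHidingOver_g`).

As in `YaoAmplification.lean` / `LiuPassCondFromRegular.lean`, the coin budget `clH` encodes the
advice at a sparse increasing sequence of *good* block lengths (`Yao.seqN`, separated by the spread
`2n + 2 + P(n)` of the input lengths `|⟨1ⁿ, f x⟩|`, so that the input length determines the block
length, `clH_eq`), it is polynomially bounded (`clH_le`), and a good length beyond the point where
`𝒜'`'s success is `< 1/(2n^d)` gives the contradiction. All proved; the only efficiency hypothesis
is the named fact `hidRun_polyTime`.

## References

* Y. Liu, R. Pass, *On one-way functions and Kolmogorov complexity*, FOCS 2020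
  (arXiv:2009.11514), Appendix, Claim (`f̂` is `𝒮`-hiding) in the proof of Lemma 5.3.
-/

namespace Literature.Computability.Cryptography

open Finset Filter Asymptotics _root_.Computability Complexity AffineStr Polynomial

/-- A nonnegative function that is not negligible is `≥ 1/n^d` infinitely often (restated from
`YaoAmplification.lean`, where it is private). [folklore] -/
theorem exists_frequently_ge_of_not_superpolynomialDecay' {u : ℕ → ℝ} (h0 : ∀ n, 0 ≤ u n)
    (h : ¬ SuperpolynomialDecay atTop (fun n : ℕ => (n : ℝ)) u) :
    ∃ k : ℕ, ∃ᶠ n : ℕ in atTop, 1 / (n : ℝ) ^ k ≤ u n := by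
  have h' := (isNegligible_iff_eventually_lt_of_nonneg h0).not.1 h
  push Not at h'
  obtain ⟨c, hc⟩ := h'
  exact ⟨c, by simpa [Filter.not_eventually, not_lt] using hc⟩

namespace L53Params

variable (Q : L53Params) (A : RandAlg (List Bool) (List Bool)) (qA : Polynomial ℕ) (r : ℕ → ℕ)

/-! ### The coin budget -/

/-- `𝒜`'s coin count at block length `n`. [folklore] -/
def κA (n : ℕ) : ℕ := A.coinLen (Q.ℓA n)

/-- **The coin count encoding the advice** `(r(n), κ)`: `min (r n) (n+1) · K_b + κ + Base · (1 + m + n)`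
(the last summand makes room for the `m + n` random bits of `𝒜'` and is invisible to the decoding).
[folklore] -/
def Code (n : ℕ) : ℕ := min (r n) (n + 1) * Q.KbH qA n + Q.κA A n + Q.BaseH qA n * (1 + Q.m n + n)

/-- The spread of the input lengths `|⟨1ⁿ, f x⟩| ≤ 2n + 2 + P(n)`. [folklore] -/
def spreadH (n : ℕ) : ℕ := 2 * n + 2 + Q.P.eval n

/-- **The coin budget of `𝒜'`** (selected block lengths `Yao.sel`). [folklore] -/
noncomputable def clH (Gs : ℕ → Prop) (l : ℕ) : ℕ :=
  if Yao.sel Gs Q.spreadH l ≤ l then Q.Code A qA r (Yao.sel Gs Q.spreadH l) else 0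

/-- A polynomial bound on `ℓ_𝒜(n) ≤ 3n + 2 + 3n^c`. [folklore] -/
noncomputable def ℓApoly : Polynomial ℕ := C 3 * X + C 2 + C 3 * X ^ Q.c

/-- A polynomial bound on the coin budget. [folklore] -/
noncomputable def clPolyH : Polynomial ℕ := (qA.comp Q.ℓApoly + 1) * ((X + 2) * (X + C 4 + C 3 * X ^ Q.c))

variable {Q A qA r}

/-- `n ≤ spreadH n`. [folklore] -/
theorem spreadH_ge (n : ℕ) : n ≤ Q.spreadH n := by unfold spreadH; omega

/-- `ℓ_𝒜(n) ≤ ℓApoly(n)`. [folklore] -/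
theorem ℓA_le (n : ℕ) : Q.ℓA n ≤ Q.ℓApoly.eval n := by
  have hm : Q.m n ≤ Q.tot n := Nat.sub_le _ _
  have hL := Q.L_le n
  unfold ℓA
  unfold tot at hm
  simp only [ℓApoly, eval_add, eval_mul, eval_C, eval_X, eval_pow]
  omega

/-- `K_b(n) ≤ q_𝒜(ℓApoly n) + 1`. [folklore] -/
theorem KbH_le (n : ℕ) : Q.KbH qA n ≤ qA.eval (Q.ℓApoly.eval n) + 1 :=
  Nat.succ_le_succ (TM2Iter.eval_mono qA (ℓA_le n))

/-- `κ(n) < K_b(n)` for a bound `q_𝒜` on `𝒜`'s coin count. [folklore] -/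
theorem κA_lt (hqA : ∀ l, A.coinLen l ≤ qA.eval l) (n : ℕ) : Q.κA A n < Q.KbH qA n := by
  unfold κA KbH; exact Nat.lt_succ_of_le (hqA _)

/-- `Code n ≤ clPolyH(n)`. [folklore] -/
theorem Code_le (hqA : ∀ l, A.coinLen l ≤ qA.eval l) (n : ℕ) : Q.Code A qA r n ≤ (Q.clPolyH qA).eval n := by
  have hK := KbH_le (Q := Q) (qA := qA) n
  have hκ := (κA_lt (Q := Q) hqA n).le
  set K := qA.eval (Q.ℓApoly.eval n) + 1 with hKdef
  have hm : Q.m n ≤ 3 * n ^ Q.c := Nat.sub_le _ _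
  have heval : (Q.clPolyH qA).eval n = K * ((n + 2) * (n + 4 + 3 * n ^ Q.c)) := by
    simp [clPolyH, eval_comp, hKdef]
  rw [heval]
  unfold Code BaseH
  have h1 : min (r n) (n + 1) * Q.KbH qA n ≤ (n + 1) * K := Nat.mul_le_mul (min_le_right _ _) hK
  have h2 : Q.κA A n ≤ K := hκ.trans hK
  have h3 : (n + 2) * Q.KbH qA n * (1 + Q.m n + n) ≤ (n + 2) * K * (1 + 3 * n ^ Q.c + n) :=
    Nat.mul_le_mul (Nat.mul_le_mul_left _ hK) (by omega)
  calc min (r n) (n + 1) * Q.KbH qA n + Q.κA A n + (n + 2) * Q.KbH qA n * (1 + Q.m n + n)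
      ≤ (n + 1) * K + K + (n + 2) * K * (1 + 3 * n ^ Q.c + n) := by omega
    _ = K * ((n + 2) * (n + 2 + 3 * n ^ Q.c)) := by ring
    _ ≤ K * ((n + 2) * (n + 4 + 3 * n ^ Q.c)) := Nat.mul_le_mul_left _ (Nat.mul_le_mul_left _ (by omega))

/-- **The coin budget is polynomially bounded.** [folklore] -/
theorem clH_le (hqA : ∀ l, A.coinLen l ≤ qA.eval l) (Gs : ℕ → Prop) (l : ℕ) : Q.clH A qA r Gs l ≤ (Q.clPolyH qA).eval l := by
  unfold clH
  split_ifs with h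
  · exact (Code_le hqA _).trans (TM2Iter.eval_mono _ h)
  · exact Nat.zero_le _

/-- **On the inputs `⟨1ⁿ, y⟩`, `|y| ≤ P(n)`, of a selected block length the budget is `Code n`.**
[folklore] -/
theorem clH_eq {Gs : ℕ → Prop} (hG : ∀ a, ∃ b, a ≤ b ∧ Gs b) (j : ℕ) {y : List Bool}
    (hy : y.length ≤ Q.P.eval (Yao.seqN Gs Q.spreadH j)) :
    Q.clH A qA r Gs (boolPair (unaryEncodeNat (Yao.seqN Gs Q.spreadH j)) y).length = Q.Code A qA r (Yao.seqN Gs Q.spreadH j) := by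
  set n := Yao.seqN Gs Q.spreadH j
  have hℓ : (boolPair (unaryEncodeNat n) y).length = 2 * n + 2 + y.length := by
    rw [length_boolPair, show (unaryEncodeNat n).length = n from unary_decode_encode_nat n]
  have h1 : n ≤ (boolPair (unaryEncodeNat n) y).length := by rw [hℓ]; omega
  have h2 : (boolPair (unaryEncodeNat n) y).length ≤ Q.spreadH n := by rw [hℓ]; unfold spreadH; omega
  have hsel : Yao.sel Gs Q.spreadH (boolPair (unaryEncodeNat n) y).length = n := Yao.sel_eq hG spreadH_ge h1 h2
  unfold clH
  rw [hsel, if_pos h1]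

/-! ### The main theorem -/

/-- `Code n` decodes to the advice and leaves room for the coins (`W = 1 + m + n`). [folklore] -/
theorem Code_eq {n : ℕ} (hj : r n ≤ n + 1) :
    Q.Code A qA r n = r n * Q.KbH qA n + Q.κA A n + Q.BaseH qA n * (1 + Q.m n + n) := by
  unfold Code; rw [min_eq_left hj]

/-- There is room: `m + n + κ ≤ Code n`. [folklore] -/
theorem room_le (n : ℕ) : Q.m n + n + Q.κA A n ≤ min (r n) (n + 1) * Q.KbH qA n + Q.κA A n + Q.BaseH qA n * (1 + Q.m n + n) := by
  have hB : 1 ≤ Q.BaseH qA n := by unfold BaseH KbH; exact Nat.one_le_iff_ne_zero.2 (by positivity)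
  nlinarith [hB, Nat.zero_le (min (r n) (n + 1) * Q.KbH qA n)]

/-- At a nonempty level the regularity index is at most `n + 1`. [folklore] -/
theorem r_le_of_regular {S : ∀ n : ℕ, Finset (List.Vector Bool n)} (hreg : IsRegularOver Q.f S r) {n : ℕ}
    (hS : (S n).Nonempty) : r n ≤ n + 1 := by
  obtain ⟨x, hx⟩ := hS
  have h1 := (hreg n x hx).1
  have h2 := preimCard_le Q.f n x.toList
  have h3 : 2 ^ (r n - 1) ≤ 2 ^ n := h1.trans h2
  have := (Nat.pow_le_pow_iff_right (by norm_num)).1 h3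
  omega

/-- A positive `hidingProb` forces `S_n ≠ ∅`. [folklore] -/
theorem nonempty_of_hidingProb_pos {S : ∀ n : ℕ, Finset (List.Vector Bool n)} {m : ℕ → ℕ} {g : List Bool → List Bool}
    {n : ℕ} (h : 0 < hidingProb g A S m n) : (S n).Nonempty := by
  by_contra hne
  rw [Finset.not_nonempty_iff_eq_empty] at hne
  simp [hidingProb, hne] at h

/-- **The hashed function `g` is `𝒮`-hiding** (Liu–Pass 2020, Appendix, Claim in the proof of
Lemma 5.3): if `f` is an `𝒮`-one-way function with regularity `r` over the saturated family `S`,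
`|f x| ≤ P(|x|)`, and the printed inverter is efficient (`hidRun_polyTime`), then
`g r (x ‖ ρ) = ρ ‖ h¹_{R₁}(x) ‖ h²_{R₂}(pad (f x))` hides `x ← S_n`. [Y. Liu, R. Pass, FOCS 2020
(arXiv:2009.11514), Appendix, Claim "`f̂(·,·)` is `𝒮`-hiding"]
[cite: LiuPassFOCS2020, Lemma 5.3 (proof, Appendix: Claim, f-hat is S-hiding)] -/
theorem isHidingOver_g {S : ∀ n : ℕ, Finset (List.Vector Bool n)} (hSOWF : IsSOWF Q.f S) (hreg : IsRegularOver Q.f S r)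
    (hsat : IsSaturated Q.f S) (hP : ∀ x : List Bool, (Q.f x).length ≤ Q.P.eval x.length) (heff : hidRun_polyTime) :
    IsHidingOver (Q.g r) S Q.m := by
  intro A hA
  by_contra hneg
  obtain ⟨d, hfreq⟩ := exists_frequently_ge_of_not_superpolynomialDecay' (fun n => hidingProb_nonneg _ A S _ n) hneg
  obtain ⟨qA, hqA⟩ := hA.2
  -- good block lengths
  set Gs : ℕ → Prop := fun n => 1 / (n : ℝ) ^ d ≤ hidingProb (Q.g r) A S Q.m n ∧ Q.γ' ≤ n ∧ 2 ≤ n with hGs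
  have hGsf : ∃ᶠ n in atTop, Gs n := hfreq.and_eventually ((eventually_ge_atTop Q.γ').and (eventually_ge_atTop 2))
  have hG' : ∀ a, ∃ b, a ≤ b ∧ Gs b := fun a => by
    obtain ⟨b, hb, hGb⟩ := frequently_atTop.1 hGsf a
    exact ⟨b, hb, hGb⟩
  -- the inverter with the advice-carrying coin budget is PPT
  set A' := Q.hidRed A qA (Q.clH A qA r Gs) with hA'
  have hPPT : IsPPT A' id := by
    refine ⟨?_, ⟨Q.clPolyH qA, clH_le hqA Gs⟩⟩
    obtain ⟨p, M, hM⟩ := heff Q A qA hA hSOWF.1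
    exact ⟨p, M, fun a => hM a⟩
  -- `𝒜'` inverts with negligible probability: eventually `< 1/(2 n^d)`
  have hdec := hSOWF.2 A' hPPT
  have hev : ∀ᶠ n : ℕ in atTop, sInvertProb Q.f A' S n < 1 / (n : ℝ) ^ (d + 1) :=
    (isNegligible_iff_eventually_lt_of_nonneg (fun n => sInvertProb_nonneg Q.f A' S n)).1 hdec (d + 1)
  obtain ⟨N₁, hN₁⟩ := eventually_atTop.1 hev
  set n := Yao.seqN Gs Q.spreadH N₁ with hn
  have hNn : N₁ ≤ n := (Yao.seqN_strictMono hG' spreadH_ge).id_le N₁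
  obtain ⟨hgood, hγ, hn2⟩ := Yao.seqN_good (w := Q.spreadH) hG' N₁
  have hn0 : (0 : ℝ) < n := by exact_mod_cast (show 0 < n by omega)
  have hpos : 0 < hidingProb (Q.g r) A S Q.m n := lt_of_lt_of_le (by positivity) hgood
  have hS : (S n).Nonempty := nonempty_of_hidingProb_pos hpos
  have hj : r n ≤ n + 1 := r_le_of_regular hreg hS
  -- the counting inequality at `n`
  have hκ : Q.κA A n < Q.KbH qA n := κA_lt hqA n
  have hcl : ∀ x ∈ S n, Q.clH A qA r Gs (boolPair (unaryEncodeNat n) (Q.f x.toList)).length =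
      r n * Q.KbH qA n + Q.κA A n + Q.BaseH qA n * (1 + Q.m n + n) := by
    intro x _
    rw [← Code_eq hj]
    refine clH_eq hG' N₁ ?_
    have := hP x.toList
    rwa [List.Vector.toList_length] at this
  have hW : Q.m n + n + Q.κA A n ≤ r n * Q.KbH qA n + Q.κA A n + Q.BaseH qA n * (1 + Q.m n + n) := by
    have := room_le (Q := Q) (A := A) (qA := qA) (r := r) n
    rwa [min_eq_left hj] at this
  have hmain := sInvertProb_ge (A := A) (qA := qA) (cl := Q.clH A qA r Gs) hsat hγ (fun x hx => (hreg n x hx).1) hj hκ rfl hcl hW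
  -- contradiction: `½ · 1/n^d ≤ ½ hidingProb ≤ sInvertProb < 1/n^{d+1} ≤ ½ · 1/n^d`
  have h1 := hN₁ n hNn
  have hn2R : (2 : ℝ) ≤ n := by exact_mod_cast hn2
  have h2 : 1 / (n : ℝ) ^ (d + 1) ≤ 2⁻¹ * (1 / (n : ℝ) ^ d) := by
    rw [pow_succ, one_div, one_div, mul_inv, mul_comm]
    exact mul_le_mul_of_nonneg_right ((inv_le_inv₀ hn0 (by norm_num)).2 hn2R) (by positivity)
  have h3 : 2⁻¹ * (1 / (n : ℝ) ^ d) ≤ 2⁻¹ * hidingProb (Q.g r) A S Q.m n := mul_le_mul_of_nonneg_left hgood (by norm_num)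
  linarith

end L53Params

end Literature.Computability.Cryptography
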